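import Summits.CriticalPhenomena.PercolationContinuityZ3.Theorems.FK.InfiniteVolumeDLRRegionTransport
import Literature.Probability.LatticeModels.RandomClusterBoxDuality
import Literature.Probability.LatticeModels.RCBoxBridge
import HarnessLib

/-!
# Planar duality of the random-cluster model, I: the finite-volume dictionary in the lineage's language —
# `φ⁰_{P_m,p,q}(ω_d ∈ S) = φ¹_{Λ_{m+1},p_d,q}(S)` for events `S` of the dual box (Grimmett 2006, §6.1 (6.3)–(6.7),
# Thm. (6.13) in finite volume)

Claimed R42 (8)(c) in the cell INBOX at 2026-08-27T17:57:30Z by fkp-10a gen 350 (NEW CLAIM #2 of the gen), addressed to coordinator fk-4 g260 (seated 17:10Z 2026-08-27; R137 l.8093); lineage row FO-10a-g350d (self-suggested), package g350-duality, label DU-A.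
Support file of the `fk-continuity` cell (lineage fkp-10a, `--supports stmt-CriticalPhenomena-4575`); builds on
p205010 (kernel theorem, internal audit signed; external expert review pending).  No definitions, no named facts,
no sorries; standard axioms.  `d = 2` only; `0 ≤ p ≤ 1`, `q > 0`.  UNCONDITIONAL structure; nothing about
`p_c(q)`, FH / TP_FK.

The tree's `Literature/…/RandomClusterBoxDuality.lean` proves Grimmett's (6.3)–(6.7): for the primal box
`P_m = [-m, m+1]²` (`pbox m`, free boundary) and its dual box `Λ_{m+1}` with the ring `∂Λ_{m+1}` wired (the outer face)
on the TOUCHING edges `touchGraph 2 m`, `φ⁰_{P_m,p,q}(A) = φ^{∂Λ_{m+1}}_{touchGraph,p_d,q}(S)` whenever `A` and `S`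
correspond under `ω ↦ ω_d` (`rcMeasure_pbox_real_eq_dual`, `p_d = rcDualParam p q = q(1-p)/(p + q(1-p))`).  This file
rewrites that identity in the vocabulary of the lineage (`regionFreeReal`, `rcBoxLaw`, the `ℤ²`-level dual configuration
`dualConfig ω = E(ℤ²) ∖ dualEdge '' ω` of `Literature/…/Percolation/Crossings.lean`):

* `touchGraph_le_finsetGraph`, `mem_boxBoundary_of_mem_sdiff` — the touching graph is the box graph minus the ring
  edges, whose endpoints lie in the wired ring;
* `liftEdges_inter_edgeFinset_touchGraph` — lifting commutes with restriction to the touching edges;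
* **`rcMeasure_touchGraph_real_eq_rcBoxLaw`** — the ring-wired measure on the touching graph agrees with the lineage's
  WIRED BOX LAW `rcBoxLaw 2 true p q (m+1)` on events determined by the touching edges (edges inside the wired ring
  are irrelevant: the tree's `rcMeasure_real_eq_of_le_of_wired`);
* `dualConfig_liftEdges_iff` — on a touching edge `d = e_d`, `d ∈ (liftEdges ω)_d ↔ e ∉ ω ↔ d ∈ liftEdges (dualConf ω)`;
* **`regionFreeReal_pbox_preimage_dualConfig`** — THE DICTIONARY: for every measurable `S` determined by the touching
  edges of `Λ_{m+1}`,
  `φ⁰_{P_m,p,q}({ω | ω_d ∈ S}) = regionFreeReal 2 p q (pbox m) (dualConfig ⁻¹' S) = (rcBoxLaw 2 true (rcDualParam p q) q (m+1)).real S`.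

The infinite-volume limit (Thm. (6.13)/(6.14): `φ⁰_{p,q} ∘ (ω ↦ ω_d)⁻¹ = φ¹_{p_d,q}`) is the companion file
`PlanarDualityInfiniteVolume.lean`.

## References

* G. Grimmett, *The Random-Cluster Model*, Springer 2006: §6.1 eqs. (6.3)–(6.7), Thm. (6.13), (6.12). [Grimmett2006]
* G. Grimmett, *Percolation*, 2nd ed., Springer 1999, §11.2 (planar duality of ℤ²). [GrimmettPercolation1999]
-/

noncomputable section

open scoped Classical
open MeasureTheory Finset Filter

namespace Summit.CriticalPhenomena.PercolationContinuityZ3.Theorems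

namespace FK

open Literature.Probability.LatticeModels Literature.Probability.Percolation
  Literature.Barriers.CriticalPhenomena

variable {m : ℕ}

/-! ### The touching graph inside the box graph -/

/-- The touching graph of `Λ_{m+1}` is a spanning subgraph of the box graph `(Λ_{m+1}, E_{Λ_{m+1}})`. [folklore] -/
theorem touchGraph_le_finsetGraph (m : ℕ) : touchGraph 2 m ≤ finsetGraph (zdGraph 2) (box 2 (m + 1)) := by
  intro x y hxy
  have he : s(x, y) ∈ (touchGraph 2 m).edgeFinset := SimpleGraph.mem_edgeFinset.2 hxy
  rw [edgeFinset_touchGraph] at he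
  exact SimpleGraph.mem_edgeFinset.1 (touchEdges_subset he)

/-- The edges of the box graph which are not touching edges have both endpoints on the ring `∂Λ_{m+1}`. [folklore] -/
theorem mem_boxBoundary_of_mem_sdiff {e : Sym2 (BoxV 2 (m + 1))}
    (he : e ∈ (finsetGraph (zdGraph 2) (box 2 (m + 1))).edgeFinset \ (touchGraph 2 m).edgeFinset) :
    ∀ z ∈ e, z ∈ boxBoundary 2 (m + 1) := by
  rw [Finset.mem_sdiff, edgeFinset_touchGraph] at he
  obtain ⟨heE, het⟩ := he
  have hnot : ¬ ∃ y ∈ e, y.1 ∈ box 2 m := by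
    intro h
    exact het (Finset.mem_filter.2 ⟨heE, h⟩)
  intro z hz
  rw [mem_boxBoundary_iff_notMem]
  exact fun hzm => hnot ⟨z, hz, hzm⟩

/-- Lifting commutes with restriction to the touching edges: `liftEdges (ω ∩ E_touch) = liftEdges ω ∩ touchEdgesSite`.
[folklore] -/
theorem liftEdges_inter_edgeFinset_touchGraph (ω : Finset (Sym2 (BoxV 2 (m + 1)))) :
    liftEdges (box 2 (m + 1)) (↑(ω ∩ (touchGraph 2 m).edgeFinset) : BondConfig (BoxV 2 (m + 1))) =
      liftEdges (box 2 (m + 1)) (↑ω : BondConfig (BoxV 2 (m + 1))) ∩ ↑(touchEdgesSite m) := by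
  rw [liftEdges_coe_eq_coe_map, liftEdges_coe_eq_coe_map, edgeFinset_touchGraph, touchEdgesSite, ← Finset.coe_inter,
    Finset.map_inter]

/-- **The ring-wired measure on the touching graph is the wired box law on events of the touching edges**: for
`0 ≤ p ≤ 1`, `q > 0`, and `S` measurable and determined by `touchEdgesSite m`,
`φ^{∂Λ_{m+1}}_{touchGraph 2 m,p,q}(liftEdges ⁻¹' S) = (rcBoxLaw 2 true p q (m+1)).real S` (the ring edges, absent from
the touching graph, have both endpoints in the wired ring and `S` does not read them: the tree's
`rcMeasure_real_eq_of_le_of_wired`). [cite: Grimmett2006, §6.1 (the outer face as the wired ring); §4.2 (4.12)] -/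
theorem rcMeasure_touchGraph_real_eq_rcBoxLaw {p q : ℝ} (hp : p ∈ Set.Icc (0 : ℝ) 1) (hq : 0 < q)
    {S : Set (BondConfig (Site 2))} (hS : DeterminedBy S ↑(touchEdgesSite m)) (hSm : MeasurableSet S) :
    (rcMeasure (touchGraph 2 m) p q (boxBoundary 2 (m + 1))).real (liftEdges (box 2 (m + 1)) ⁻¹' S) =
      (rcBoxLaw 2 true p q (m + 1)).real S := by
  rw [← regionWiredReal_box p q (m + 1) hSm, regionWiredReal]
  symm
  refine rcMeasure_real_eq_of_le_of_wired _ _ (touchGraph_le_finsetGraph m) hp hq _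
    (fun e he => mem_boxBoundary_of_mem_sdiff he) fun ω _ => ?_
  rw [Set.mem_preimage, Set.mem_preimage, liftEdges_inter_edgeFinset_touchGraph]
  refine (determinedBy_iff _ _).1 hS _ _ ?_
  rw [Set.inter_assoc, Set.inter_self]

/-! ### The dual configuration of a lifted primal configuration -/

/-- A touching edge is the dual of a unique edge of the primal box: for `d ∈ touchEdgesSite m`,
`dualEdgeEquiv.symm d ∈ pboxEdges m` and `dualEdge (dualEdgeEquiv.symm d) = d`. [cite: Grimmett2006, §6.1 (6.3)] -/
theorem dualEdgeEquiv_symm_mem_pboxEdges {d : Sym2 (Site 2)} (hd : d ∈ touchEdgesSite m) :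
    dualEdgeEquiv.symm d ∈ pboxEdges m := by
  rw [← map_dualEdge_pboxEdges, Finset.mem_map_equiv] at hd
  exact hd

/-- **On a touching edge the dual of the lifted primal configuration is the lifted `dualConf`**: for a configuration
`ω` of the primal box and `d ∈ touchEdgesSite m`, `d ∈ dualConfig (liftEdges (pbox m) ω) ↔ d ∈ liftEdges (Λ_{m+1}) (dualConf m ω)`
(both say: the primal edge crossed by `d` is closed). [cite: Grimmett2006, §6.1 eq. (6.3) (ω_d(e_d) = 1 − ω(e))] -/
theorem dualConfig_liftEdges_iff (ω : Finset (Sym2 (PBoxV m))) {d : Sym2 (Site 2)} (hd : d ∈ touchEdgesSite m) :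
    d ∈ dualConfig (liftEdges (pbox m) (↑ω : BondConfig (PBoxV m))) ↔
      d ∈ liftEdges (box 2 (m + 1)) (↑(dualConf m ω) : BondConfig (BoxV 2 (m + 1))) := by
  have hdE : d ∈ (zdGraph 2).edgeSet := (mem_touchEdgesSite_iff.1 hd).1
  rw [dualConfig_eq, Set.mem_setOf_eq, liftEdges_coe_eq_coe_map, liftEdges_coe_eq_coe_map, Finset.mem_coe,
    Finset.mem_coe, map_dualConf, mem_dualOf_iff]
  constructor
  · rintro ⟨-, hnot⟩
    exact ⟨dualEdgeEquiv.symm d, dualEdgeEquiv_symm_mem_pboxEdges hd, hnot, by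
      rw [← dualEdgeEquiv_apply, Equiv.apply_symm_apply]⟩
  · rintro ⟨e, -, heω, hed⟩
    refine ⟨hdE, ?_⟩
    have : dualEdgeEquiv.symm d = e := by
      rw [Equiv.symm_apply_eq, dualEdgeEquiv_apply, hed]
    rwa [this]

/-! ### The dictionary -/

/-- **Finite-volume planar duality in the lineage's language** (Grimmett 2006 (6.3)–(6.7), the tree's
`rcMeasure_pbox_real_eq_dual`): for `0 ≤ p ≤ 1`, `q > 0`, and every measurable event `S` determined by the touching
edges of `Λ_{m+1}`,
`regionFreeReal 2 p q (pbox m) (dualConfig ⁻¹' S) = (rcBoxLaw 2 true (rcDualParam p q) q (m+1)).real S`: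
the free random-cluster measure of the primal box `P_m = [-m,m+1]²`, pushed forward by `ω ↦ ω_d`, is the wired
random-cluster law of the dual box `Λ_{m+1}` at the dual parameter `p_d = q(1-p)/(p + q(1-p))`, on such events.
[cite: Grimmett2006, §6.1 eqs. (6.3)–(6.7) and Thm. (6.13) eq. (6.12)] -/
theorem regionFreeReal_pbox_preimage_dualConfig {p q : ℝ} (hp : p ∈ Set.Icc (0 : ℝ) 1) (hq : 0 < q)
    {S : Set (BondConfig (Site 2))} (hS : DeterminedBy S ↑(touchEdgesSite m)) (hSm : MeasurableSet S) :
    regionFreeReal 2 p q (pbox m) (dualConfig ⁻¹' S) = (rcBoxLaw 2 true (rcDualParam p q) q (m + 1)).real S := by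
  rw [← rcMeasure_touchGraph_real_eq_rcBoxLaw (rcDualParam_mem_Icc hp hq) hq hS hSm, regionFreeReal,
    rcMeasure_congr (show finsetGraph (zdGraph 2) (pbox m) = pboxGraph m from rfl)]
  refine rcMeasure_pbox_real_eq_dual hp hq fun ω _ => ?_
  rw [Set.mem_preimage, Set.mem_preimage, Set.mem_preimage]
  refine (determinedBy_iff _ _).1 hS _ _ ?_
  ext d
  simp only [Set.mem_inter_iff, Finset.mem_coe]
  constructor
  · rintro ⟨h1, h2⟩
    exact ⟨(dualConfig_liftEdges_iff ω h2).1 h1, h2⟩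
  · rintro ⟨h1, h2⟩
    exact ⟨(dualConfig_liftEdges_iff ω h2).2 h1, h2⟩

end FK

end Summit.CriticalPhenomena.PercolationContinuityZ3.Theorems

end
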